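import Summits.ABC.ABC.Theses.YuMatveevShapeRat
import HarnessLib

set_option linter.dupNamespace false

/-!
# Route YuMatveevShapeRat (rung F-A1.L = `Dioph.approximationBound_rat`, the Baker-method library rung over `ℚ`):
# the `Assembly` (stmt-ABC-20505)

`Summits/ABC/ABC/Theorems/YuMatveevShapeRatClosers.lean` — cell `abc-stewartyu`, seat p4 (g9, closer seat).
The route (planner g11, born 2026-08-27T14:32:52Z on HUMAN D-0137) closes the rung leaf
`Literature.NumberTheory.DiophantineGeometry.Dioph.approximationBound_rat` from the three engine texts
`ArchCoreRat` (stmt-ABC-20502), `PadicCoreOddRat` (stmt-ABC-20503), `PadicCoreTwoRat` (stmt-ABC-20504)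
through lp-1's landed Literature chain theorem `Dioph.approximationBound_rat_of_cores`; its Assembly item
is the route's own deciding theorem `closes`. [folklore] composition (M3 precedent:
`PadicPrimesKummerThirdClosers.lean`).
WHAT THIS IS NOT: the three engine cruxes are untouched; no summit credit (class rung, FRONTIER ledger).
-/

namespace Summit.ABC.ABC.Theorems

/-- **Item stmt-ABC-20505 `Assembly`** of route `YuMatveevShapeRat`:
`ArchCoreRat → PadicCoreOddRat → PadicCoreTwoRat → Dioph.approximationBound_rat`, by the route's `closes`
(`Dioph.approximationBound_rat_of_cores`). [folklore] -/
theorem yuMatveevShapeRat_assembly_proof :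
    Summit.ABC.ABC.Theses.YuMatveevShapeRat.Assembly :=
  fun h₁ h₂ h₃ => Summit.ABC.ABC.Theses.YuMatveevShapeRat.closes h₁ h₂ h₃

end Summit.ABC.ABC.Theorems
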